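import Literature.AnabelianGeometry.EtaleTheta.ThetaTrivializationsOfFunctions
import Literature.AnabelianGeometry.EtaleTheta.ThetaKummerInputDeckOfCore
import Literature.AnabelianGeometry.EtaleTheta.Discharge.Sec1ConstCompatSchema
import Literature.AnabelianGeometry.EtaleTheta.KummerContH1Kernel
import Literature.AnabelianGeometry.EtaleTheta.SettingModelChiDeltaTheta
import HarnessLib

/-!
# [EtTh] Lem. 1.2 in the Kummer theory of functions — THE INSTANCE AT THE χ-TWISTED ROOT MODEL `modelχ`

S. Mochizuki, *The étale theta function …*, Publ. RIMS **45** (2009) [EtTh], §1 Lem. 1.2 (PRIMS PDF p. 19,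
printed 245), Prop. 1.1 (i) (p. 15), Prop. 1.4 (ii) (p. 22) [cite: MochizukiEtTh2009, Lem 1.2 p.19].  abc-iut
cell, layer L2, seat abc-iut-w5-d171 (gen 7), row «LEM12-FD» (L2-lead R1045); PROOF-ONLY sequel of
`ThetaTrivializationsOfFunctions.lean` (the `s`-dictionary datum `ThetaKummerInput.lineBundleData` and
`Lem12`/`Prop11i`/level-1 sign law for it).  Inputs BY NAME: abc-iut-w5-d125's
`SettingModel.exists_thetaKummerInput_deck_modelχ` (p454127: at `modelχ` a theta-Kummer input — the
`Ü`-monomial module over abc-iut-w5-d171's `kummerCoreχ`/`yCoordχ` — with `Λ(Fn) ≅ Δ_Θ` bijective,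
`ConstCompat kummerDataχ` and the deck identity `ε • Θ̈ = const(−1)·Θ̈` off `Π^tp_Ÿ`), abc-iut-f-117's
`kummerConst_neg_one_ne_one_of_constCompat`, `bijective_deltaThetaCoordχ` (`Δ_Θ(modelχ) ≅ Ẑ`) and the
`Ẑ`-level API `ZHatLevel.level_eq_one_iff_exists_pow` / `exists_level_eq_level_eta`.

WHAT.
* `cyclotome.exists_pow_eq_of_apply_eq_one` — `Ker(Λ(A) → A[m]) = Λ(A)^m` (general).
* `ThetaKummerInput.generator_of_mulEquiv_zHat` — any group isomorphism `Φ : Ẑ ≃* Λ(Fn)` yields a GENERATOR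
  `ξ := Φ(η 1)`: primitive components `ξ_N` and topological generation (`x_N ∈ ξ_N^ℤ` for `x ∈ Λ(Fn)`).
* `ThetaKummerInput.const_neg_one_ne_one_of_constCompat` — `ConstCompat ⇒ const(−1) ≠ 1` in `Fn`.
* `SettingModel.exists_lineBundleData_lem12_modelχ` — **at `modelχ` there is a line-bundle datum (the
  `s`-dictionary of p454127's function module) satisfying `Lem12` AND `Prop11i`, together with the level-1 SIGN
  LAW**: for its theta trivialisation `τ_1` and every `g ∈ Π^tp_Y`, the root of unity `ζ ∈ μ_2` for which
  `ζ ·`(Prop. 1.1 (ii) action of `g`) preserves `τ_1` is `1` iff `g ∈ Π^tp_Ÿ` — the discrepancy `−1` off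
  `Π^tp_Ÿ` is REALISED (at the toy datum it is `1` throughout).

HONEST FRAMING.  `modelχ` is SEMI-SYNTHETIC (consistency evidence for the typed interface only); a dictionary
over a theta-Kummer input, NOT a curve carrier (FOUNDATIONS row 14 unchanged; EtTh:Lem1.2 / Prop1.1 stay
FACT-policy); `Prop11ii` is not reached (see the parent file).  Nothing of [EtTh] is asserted; no side is taken
on [IUTchIII] Cor. 3.12; typed ≠ proved.
-/

noncomputable section

namespace Literature.AnabelianGeometry.EtaleTheta

open Literature.AnabelianGeometry.SemiGraphs

namespace cyclotome

variable {A : Type*} [CommGroup A]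

/-- **`Ker(Λ(A) → A[m]) = Λ(A)^m`**: if the level-`m` component of `x ∈ Λ(A)` is trivial then `x` is an
`m`-th power in the cyclotome — of `y_n := x_{mn}`. [cite: LANA2026Report, §6.1 p.31] -/
theorem exists_pow_eq_of_apply_eq_one (x : cyclotome A) (m : ℕ+) (hx : (x : ℕ+ → A) m = 1) :
    ∃ y : cyclotome A, y ^ (m : ℕ) = x := by
  refine ⟨⟨fun n => (x : ℕ+ → A) (m * n), fun n => ?_, fun n k => ?_⟩, ?_⟩
  · change (x : ℕ+ → A) (m * n) ^ (n : ℕ) = 1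
    rw [cyclotome.pow_apply_mul, hx]
  · change (x : ℕ+ → A) (m * (n * k)) ^ (k : ℕ) = (x : ℕ+ → A) (m * n)
    rw [← mul_assoc]
    exact cyclotome.pow_apply_mul x (m * n) k
  · apply Subtype.ext
    funext n
    change (x : ℕ+ → A) (m * n) ^ (m : ℕ) = (x : ℕ+ → A) n
    rw [mul_comm]
    exact cyclotome.pow_apply_mul x n m

end cyclotome

namespace ThetaSetting

namespace ThetaKummerInput

variable {p : ℕ} [Fact p.Prime] {D : ThetaSetting p} (T : D.ThetaKummerInput)

/-! ### A generator of `Λ(Fn)`, and `const(−1) ≠ 1` -/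

/-- A `ConstCompat` theta-Kummer input has a non-trivial constant `−1` in its function module: if
`const(−1) = 1` then its Kummer class (computed with any compatible root system) is that of the invariant
trivial root system, i.e. `1`, contradicting `kummerConst_neg_one_ne_one_of_constCompat`.
[cite: MochizukiEtTh2009, Prop 1.3 p.21] -/
theorem const_neg_one_ne_one_of_constCompat {E : D.KummerData} (hcc : T.ConstCompat E) :
    T.const (-1) ≠ 1 := by
  intro h1
  let d : RootSystem (T.const (-1)) := RootSystem.one.cast h1.symm
  have hdinv : d.IsInvariant D.GtpYdd := fun n h => by
    change (h : D.PiTemp) • (1 : T.Fn) = 1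
    exact smul_one _
  have hK : T.kummerConst (-1) = 1 := by
    rw [kummerConst, T.coeff.kummerContClass_eq D.GtpYdd (T.constRoots (-1)) d (T.const_mem (-1)) _
      (fun _ => T.isOpen_stabilizer _)]
    exact T.coeff.kummerContClass_eq_one_of_isInvariant D.GtpYdd d hdinv (T.const_mem (-1)) _
  exact T.kummerConst_neg_one_ne_one_of_constCompat hcc hK

/-- **A generator of `Λ(Fn)` from `Λ(Fn) ≅ Ẑ`.** If `Φ : Ẑ ≃* Λ(Fn)` is a group isomorphism, then
`ξ := Φ(η(1))` has primitive components and topologically generates: every `x ∈ Λ(Fn)` is `ξ^k · y^N`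
(`Ẑ = η(ℤ) · Ẑ^N`, `ZHatLevel.level_eq_one_iff_exists_pow`), so `x_N = ξ_N^k`; and `ξ_N^l = 1` forces
`ξ^l ∈ Λ(Fn)^N` (`cyclotome.exists_pow_eq_of_apply_eq_one`), i.e. `η(l) ∈ Ẑ^N`, i.e. `N ∣ l`.
[cite: RibesZalesskii2010, Thm 2.7.1] -/
theorem generator_of_mulEquiv_zHat (Φ : SettingModel.ZH ≃* cyclotome T.Fn) :
    (∀ N : ℕ+, IsPrimitiveRoot ((Φ (ZHatLevel.eta 1) : ℕ+ → T.Fn) N) N) ∧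
      ∀ (x : cyclotome T.Fn) (N : ℕ+),
        ∃ k : ℤ, (x : ℕ+ → T.Fn) N = (Φ (ZHatLevel.eta 1) : ℕ+ → T.Fn) N ^ k := by
  -- `Ẑ = η(ℤ) · Ẑ^N`
  have hdec : ∀ (t : SettingModel.ZH) (N : ℕ+), ∃ (k : ℤ) (s : SettingModel.ZH),
      t = ZHatLevel.eta 1 ^ k * s ^ (N : ℕ) := by
    intro t N
    obtain ⟨k, hk⟩ := ZHatLevel.exists_level_eq_level_eta N t
    have h1 : ZHatLevel.level N ((ZHatLevel.eta k)⁻¹ * t) = 1 := by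
      rw [map_mul, map_inv, hk, inv_mul_cancel]
    obtain ⟨s, hs⟩ := (ZHatLevel.level_eq_one_iff_exists_pow N _).mp h1
    refine ⟨k, s, ?_⟩
    rw [← ZHatLevel.eta_eq_zpow]
    exact inv_mul_eq_iff_eq_mul.mp hs.symm
  refine ⟨fun N => ?_, fun x N => ?_⟩
  · -- primitivity of `ξ_N`
    haveI : NeZero ((N : ℕ+) : ℕ) := ⟨PNat.ne_zero _⟩
    rw [IsPrimitiveRoot.iff_def]
    refine ⟨cyclotome.pow_eq_one _ N, fun l hl => ?_⟩
    have h1 : ((Φ (ZHatLevel.eta 1) ^ l : cyclotome T.Fn) : ℕ+ → T.Fn) N = 1 := by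
      rw [Subgroup.coe_pow, Pi.pow_apply, hl]
    obtain ⟨y, hy⟩ := cyclotome.exists_pow_eq_of_apply_eq_one _ N h1
    have h2 : (Φ.symm y) ^ (N : ℕ) = ZHatLevel.eta (l : ℤ) := by
      rw [← map_pow, hy, map_pow, Φ.symm_apply_apply, ZHatLevel.eta_eq_zpow (l : ℤ), zpow_natCast]
    have h3 : ZHatLevel.level N (ZHatLevel.eta (l : ℤ)) = 1 := by
      rw [← h2]
      exact ZHatLevel.level_pow_self N _
    rw [ZHatLevel.level_eta, ← ofAdd_zero, Multiplicative.ofAdd.apply_eq_iff_eq,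
      ZMod.intCast_zmod_eq_zero_iff_dvd] at h3
    exact Int.natCast_dvd_natCast.mp h3
  · -- generation at level `N`
    obtain ⟨k, s, hks⟩ := hdec (Φ.symm x) N
    refine ⟨k, ?_⟩
    have hx : x = Φ (ZHatLevel.eta 1) ^ k * Φ s ^ (N : ℕ) := by
      rw [← map_zpow, ← map_pow, ← map_mul, ← hks, Φ.apply_symm_apply]
    rw [hx, Subgroup.coe_mul, Subgroup.coe_pow, SubgroupClass.coe_zpow, Pi.mul_apply, Pi.pow_apply,
      Pi.pow_apply, cyclotome.pow_eq_one, mul_one]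

end ThetaKummerInput

end ThetaSetting

/-! ### The instance at `modelχ` -/

namespace SettingModel

variable (p : ℕ) [Fact p.Prime]

/-- **[EtTh] Lem. 1.2 WITNESSED AT THE χ-TWISTED ROOT MODEL in the Kummer theory of functions, with the
sign mechanism.** From abc-iut-w5-d125's function module at `modelχ` (p454127: `Λ(Fn) ≅ Δ_Θ` bijective,
`ConstCompat kummerDataχ`, deck identity `ε • Θ̈ = const(−1)·Θ̈` off `Π^tp_Ÿ`) and `Δ_Θ(modelχ) ≅ Ẑ`
(`bijective_deltaThetaCoordχ`): there is a line-bundle datum over `modelχ` — the `s`-dictionary datum of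
that module — satisfying `Lem12`, TOGETHER WITH the level-1 sign law: for its theta trivialisation `τ_1`
and every `g ∈ Π^tp_Y`, the root of unity `ζ ∈ μ_2` for which `ζ ·` (Prop. 1.1 (ii) action of `g`) preserves
`τ_1` is `1` iff `g ∈ Π^tp_Ÿ` (so it is `−1` off `Π^tp_Ÿ`).  SEMI-SYNTHETIC model: consistency evidence for
the typed interface only; nothing of [EtTh] asserted. [cite: MochizukiEtTh2009, Lem 1.2 p.19] -/
theorem exists_lineBundleData_lem12_modelχ :
    ∃ L : (ThetaSetting.modelχ p).LineBundleData, ThetaSetting.Lem12 L ∧ ThetaSetting.Prop11i L ∧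
      ∃ τ : L.SecDd 1, L.IsThetaTriv 1 τ ∧
        ∀ (g : (ThetaSetting.modelχ p).PiTemp) (hg : g ∈ (ThetaSetting.modelχ p).GtpY)
          (ζ : Multiplicative (ZMod (2 * ((1 : ℕ+) : ℕ)))),
          L.Preserves 1 (L.rootAct 1 ζ * L.actProp11 1 ⟨g, hg⟩) τ ↔
            (ζ = 1 ↔ g ∈ (ThetaSetting.modelχ p).GtpYdd) := by
  obtain ⟨T, hbij, hcc, hdeck⟩ := exists_thetaKummerInput_deck_modelχ p
  letI := T.instAction
  -- `Λ(Fn) ≅ Δ_Θ(modelχ) ≅ Ẑ`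
  let E₁ : cyclotome T.Fn ≃* (ThetaSetting.modelχ p).DeltaTheta := MulEquiv.ofBijective T.coeff.hom hbij
  let E₂ : ZH ≃* (ThetaSetting.modelχ p).DeltaTheta :=
    MulEquiv.ofBijective (deltaThetaCoordχ p) (bijective_deltaThetaCoordχ p)
  let Φ : ZH ≃* cyclotome T.Fn := E₂.trans E₁.symm
  obtain ⟨hξ, hgen⟩ := T.generator_of_mulEquiv_zHat Φ
  have hneg : T.const (-1) ≠ 1 := T.const_neg_one_ne_one_of_constCompat hcc
  refine ⟨T.lineBundleData _ hξ, T.lem12_lineBundleData_of_deck _ hξ hgen hdeck,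
    T.prop11i_lineBundleData _ hξ, T.thetaRoots.root 1,
    ⟨1, ?_⟩, fun g hg ζ => ?_⟩
  · rw [map_one, one_mul, T.thetaRoots.root_one, PNat.one_coe, pow_one]
  · by_cases hdd : g ∈ (ThetaSetting.modelχ p).GtpYdd
    · rw [T.preserves_one_iff_of_mem_GtpYdd _ hξ hg hdd ζ]
      simp only [hdd, iff_true]
    · rw [T.preserves_one_iff_of_deck _ hξ hgen hneg hg (hdeck g hg hdd) ζ]
      simp only [hdd, iff_false]

end SettingModel

end Literature.AnabelianGeometry.EtaleTheta

end
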